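import Summits.BirchSwinnertonDyer.Rank1Residual.X11b.KolyvaginPointRestriction
import HarnessLib

/-!
# T1 JET (cell `bsd-jet`), road K — striking McCallum 1991 Prop. 5.2 (`h52`), brick 3: the SWAP WALK
# (pure combinatorics: swapping out the primes of small index one at a time terminates)

HONEST FRAMING (programme file §HONESTY, verbatim): «no tranche here proves BSD; ARM L moves the
LITERAL column of an r ≤ 1 census into the kernel-proved-modulo-named-print column.» THEOREMS ONLY
(seat `bsd-jet-pv-2`, session g6; `--supports stmt-BirchSwinnertonDyer-14418`, helper); 0 classes move;
road-K DOCUMENTARY. Nothing is asserted about any curve; no item closes.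

WHAT. The induction skeleton of Kolyvagin's prime-swap walk behind McCallum 1991 Prop. 5.2 (LMS LN 153,
proof pp. 305–306: "Replacing `n` by `nl'/l_0` … and hence eventually …"): for an index function `M`,
a target `m'` and an invariant `Good` on square-free conductors that survives ONE swap of a prime
`ℓ₀ ∣ n` of index `< m'` for a fresh prime `ℓ'` of index `≥ m'` (`hstep`, the content of bricks 2a/2b
`Swap.exists_swapPrime` / `Swap.not_dvd_of_swap` once the compatible data are supplied), every `Good`
conductor leads to a `Good` conductor all of whose primes have index `≥ m'`
(`exists_forall_le_index_of_swapStep`; induction on the number of primes of index `< m'`, which drops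
by one per swap: `card_badPrimes_swap`). No curve, no cohomology. References (locators only):
[cite: McCallumLMS1991, §5, proof of Prop. 5.2 (pp. 305–306)] [cite: Jetchev2008, proof of Thm. 1.4
(p. 824), citing [Kol91b, Thm. 1]]. Design: no definitions. Axioms: `propext`, `Classical.choice`,
`Quot.sound`.
-/

set_option autoImplicit false

open scoped Classical
open Finset Summit.BirchSwinnertonDyer.Rank1Residual.X11b.KolyvaginTowerLift

namespace Summit.BirchSwinnertonDyer.Rank1Residual.JET.Swap

/-- **Prime factors after one swap**: for `n` square-free, a prime `ℓ₀ ∣ n` and a prime `ℓ'`,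
`(n/ℓ₀ · ℓ').primeFactors = insert ℓ' (n.primeFactors.erase ℓ₀)`. [folklore] -/
theorem primeFactors_swap {n ℓ₀ ℓ' : ℕ} (hn : Squarefree n) (hℓ₀ : ℓ₀ ∈ n.primeFactors)
    (hℓ' : ℓ'.Prime) :
    (n / ℓ₀ * ℓ').primeFactors = insert ℓ' (n.primeFactors.erase ℓ₀) := by
  have hn0 : n ≠ 0 := hn.ne_zero
  have hℓ₀p : ℓ₀.Prime := Nat.prime_of_mem_primeFactors hℓ₀
  have hℓ₀n : ℓ₀ ∣ n := Nat.dvd_of_mem_primeFactors hℓ₀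
  have hm0 : n / ℓ₀ ≠ 0 := (hn.squarefree_of_dvd (Nat.div_dvd_of_dvd hℓ₀n)).ne_zero
  rw [Nat.primeFactors_mul hm0 hℓ'.ne_zero, hℓ'.primeFactors, primeFactors_div_eq_erase hn hℓ₀p hℓ₀n,
    Finset.union_comm]
  rfl

/-- **The swapped conductor is square-free.** [folklore] -/
theorem squarefree_swap {n ℓ₀ ℓ' : ℕ} (hn : Squarefree n) (hℓ₀ : ℓ₀ ∈ n.primeFactors)
    (hℓ' : ℓ'.Prime) (hℓ'n : ℓ' ∉ n.primeFactors) : Squarefree (n / ℓ₀ * ℓ') := by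
  have hn0 : n ≠ 0 := hn.ne_zero
  have hℓ₀n : ℓ₀ ∣ n := Nat.dvd_of_mem_primeFactors hℓ₀
  have hm : Squarefree (n / ℓ₀) := hn.squarefree_of_dvd (Nat.div_dvd_of_dvd hℓ₀n)
  have hℓ'm : ¬ ℓ' ∣ n / ℓ₀ := fun h ↦
    hℓ'n (Nat.mem_primeFactors.mpr ⟨hℓ', h.trans (Nat.div_dvd_of_dvd hℓ₀n), hn0⟩)
  exact (Nat.squarefree_mul ((Nat.Prime.coprime_iff_not_dvd hℓ').mpr hℓ'm).symm).mpr
    ⟨hm, hℓ'.squarefree⟩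

/-- **One swap removes one prime of small index**: with `M ℓ₀ < m' ≤ M ℓ'`, the number of prime
factors of index `< m'` drops by one from `n` to `n/ℓ₀ · ℓ'`. [cite: McCallumLMS1991, §5 proof of
Prop. 5.2 (p. 306: "we add ψ to X and increase k to k+1")] -/
theorem card_badPrimes_swap (M : ℕ → ℕ) (m' : ℕ) {n ℓ₀ ℓ' : ℕ} (hn : Squarefree n)
    (hℓ₀ : ℓ₀ ∈ n.primeFactors) (hMℓ₀ : M ℓ₀ < m') (hℓ' : ℓ'.Prime) (hMℓ' : m' ≤ M ℓ') :
    ((n / ℓ₀ * ℓ').primeFactors.filter (fun q ↦ M q < m')).card + 1 =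
      (n.primeFactors.filter (fun q ↦ M q < m')).card := by
  rw [primeFactors_swap hn hℓ₀ hℓ', Finset.filter_insert, if_neg (not_lt.mpr hMℓ'),
    Finset.filter_erase, Finset.card_erase_add_one]
  exact Finset.mem_filter.mpr ⟨hℓ₀, hMℓ₀⟩

/-- **The swap walk terminates** (McCallum 1991, proof of Prop. 5.2, pp. 305–306: "Replacing `n` by
`nl'/l_0` … eventually … `S ⊂ S(M)`"). For an index function `M : ℕ → ℕ`, a target `m'`, and a
predicate `Good` on natural numbers implying square-freeness and stable under ONE swap of any prime
factor of index `< m'` for some fresh prime of index `≥ m'` (`hstep`): from any `Good n₀` there is a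
`Good n` all of whose prime factors have index `≥ m'`. Induction on `#{q ∣ n : M q < m'}`.
[cite: McCallumLMS1991, §5 proof of Prop. 5.2 (pp. 305–306)] -/
theorem exists_forall_le_index_of_swapStep (M : ℕ → ℕ) (m' : ℕ) (Good : ℕ → Prop)
    (hsq : ∀ n, Good n → Squarefree n)
    (hstep : ∀ n, Good n → ∀ ℓ₀ ∈ n.primeFactors, M ℓ₀ < m' →
      ∃ ℓ' : ℕ, ℓ'.Prime ∧ ℓ' ∉ n.primeFactors ∧ m' ≤ M ℓ' ∧ Good (n / ℓ₀ * ℓ'))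
    {n₀ : ℕ} (h₀ : Good n₀) :
    ∃ n : ℕ, Good n ∧ ∀ q ∈ n.primeFactors, m' ≤ M q := by
  -- induction on the number of prime factors of index `< m'`
  suffices H : ∀ (B : ℕ) (n : ℕ), Good n → (n.primeFactors.filter (fun q ↦ M q < m')).card = B →
      ∃ n' : ℕ, Good n' ∧ ∀ q ∈ n'.primeFactors, m' ≤ M q from H _ n₀ h₀ rfl
  intro B
  induction B with
  | zero =>
    intro n hn hB
    refine ⟨n, hn, fun q hq ↦ ?_⟩
    by_contra hlt
    rw [not_le] at hlt
    have : q ∈ n.primeFactors.filter (fun q ↦ M q < m') := Finset.mem_filter.mpr ⟨hq, hlt⟩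
    rw [Finset.card_eq_zero.mp hB] at this
    exact Finset.notMem_empty q this
  | succ B ih =>
    intro n hn hB
    -- a prime of small index exists
    have hne : (n.primeFactors.filter (fun q ↦ M q < m')).Nonempty := by
      rw [← Finset.card_pos, hB]; exact Nat.succ_pos B
    obtain ⟨ℓ₀, hℓ₀⟩ := hne
    obtain ⟨hℓ₀n, hMℓ₀⟩ := Finset.mem_filter.mp hℓ₀
    obtain ⟨ℓ', hℓ', hℓ'n, hMℓ', hgood⟩ := hstep n hn ℓ₀ hℓ₀n hMℓ₀
    refine ih (n / ℓ₀ * ℓ') hgood ?_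
    have := card_badPrimes_swap M m' (hsq n hn) hℓ₀n hMℓ₀ hℓ' hMℓ'
    omega

end Summit.BirchSwinnertonDyer.Rank1Residual.JET.Swap
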